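import Summits.QuantumFields.YangMills.Theorems.BalabanUVNodesN07TowerGaugeCoverLiftWindow
import Literature.MathematicalPhysics.QuantumFieldTheory.Balaban1983to89.B7Prop2Rec
import Literature.MathematicalPhysics.QuantumFieldTheory.Balaban1983to89.B8Ineq132Rec
import HarnessLib

/-!
# N07 [B11] (= [15] = [Balaban1985Variational]) Sect. F — **THE (0.4) GUARD ON THE WINDOWS FROM THE DOOR's OWN INPUT** `U₀ ∈ 𝔄_k({□̃ᶻ}, α)`: [3] Prop. 2 for the record (dag-n05-e
# `B7Prop2Rec`) on the CLAMPED lift puts every loop variable of every level's average within `2θ` of `1`; hence FILE-2∕3's identification of the door's `v = localGaugeZ …` with the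
# chart's `h̄·w` holds under EXACTLY the door's hypotheses + numeric thresholds on `α·L²` (g10's knit item (3c), closing file)

Cell `pub-ymgap`, width seat `pub-ymgap-dag-n07-w3` g11 (N05-REC R7 → THE KNIT).  `--kind proof --supports stmt-QuantumFields-20541 --as helper` (K0⁷; count-neutral).  THEOREMS ONLY.
[3] = [Balaban1985Averaging]; [6] = [Balaban1985RegularSpaces]; [15] = [Balaban1985Variational]; [I] = [Balaban1987RG1].

WHY.  FILE-3 (`…TowerGaugeCoverLiftWindow`, p724608) displayed the (0.4) guard `hs` (smallness of the record averages' loop variables over the label windows).  The door's input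
`InAk L k η_k α (fun _ => □̃ᶻ) V` ([6] (1.7)∕(1.9) for the top-anchored lift on `□̃`, g10 FILE-8 `inAk_coverLiftShift_tcubeZ_of_top`) gives it: `sup_{p ⊂ □̃} |V(∂p) − 1| < αL²·L^{−2k}`
(n05-d `pdevOn_lt_of_inAk_box`), so the CLAMPED field `V_c = clampCfg (tlo k) (thi k) V` has `sup_p |V_c(∂p) − 1| ≤ …` globally (`pdev_clampCfg_le`), and [3] Prop. 2 for the record
(`B7Prop2Rec.prop2_explicitZ`, at every level `j ≤ k`) with p. 25's loop estimate (`norm_WZ_sub_one_le_global`) bounds every (0.4) loop variable of `Ū_cʲ` by `2θ`,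
`θ = 8(d+1)(d+4)L²·(2αL²)`; with `2θ < δ_N` the guard holds, and the guarded averages of `V` agree with the unguarded averages of `V_c` on the windows (FILE-3's locality, run against the
clamped field), whence `localGaugeZ = tgZ(avgIterZG V)` on `□̃ᶻ` and FILE-2.

WHAT IS PROVED (kernel; axioms standard).
§1 ★ `norm_WZ_avgIterZ_sub_one_le` (generic C⋆-algebra `𝔸`, unitary-valued `V` on `ℤᵈ`, `sup_p |V(∂p) − 1| < α₀L^{−2k}`, Prop. 2's window): `‖W_i(Ū_cʲ) − 1‖ ≤ 2θ` for EVERY `j ≤ k`,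
   every base point, every loop index.
§2 ★ `avgIterZ_clampCfg_agree_avgIterZG_of_smallZ` (generic `𝔸`): under the clamped field's loop smallness at the windows' base points, `avgIterZ L V_c j = avgIterZG L δ V j` on the bonds of
   the depth-`(k−j)` cube (induction; the guarded average's guard at `L•q` IS the clamped one's by `WZ_congr`); ★★ `localGaugeZ_eq_tgZ_avgIterZG_of_smallZ_clamp`.
§3 ★★★ `localGaugeZ_coverLiftShift_eq_of_inAk` (torus, `SU(N)`): from `InAk P.L k (P.eta k) α (fun _ => tcubeZ L a M ρ k) V`, `0 < α`, `C₀(αL²) ≤ 1∕3`, `2(αL²) ≤ c₂′`,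
   `512(d+1)(d+4)L²·2(αL²) ≤ 1`, `2θ < δ_N`, a RESIDUAL radial-tower `w`, `1 ≤ M`, `M + 4ρ ≤ sitesPerDir k`, `x ∈ □̃ᶻ`:
   `localGaugeZ L (tLo a ρ) (tHi a M ρ) V k (ctr a M) x = ιSU (blockLift k (axialGaugeAt (M^k(U^w)) (tLo a ρ) (tHi a M ρ) (ctr a M)) (π(x + c_k·𝟙)) · w (π(x + c_k·𝟙)))`.
HONEST FRAMING: count-neutral kernel bookkeeping by name (dag-n05-e `B7Prop2Rec`, dag-n05-d `B8Ineq132Rec` ∕ `B8Ineq130Rec` ∕ `B7Prop1Local`, this lineage's FILE-2∕3); no estimate of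
[3]∕[6]∕[15]∕[I] newly asserted (Prop. 2 for the record is dag-n05-e's LANDED theorem, consumed by name); RADIAL contours (the door as landed) — the A3⁵ road word is not prejudged;
`HThm4RecDbar` ∕ `HThm4Rec` UNDISCHARGED (caveat (C-S3-1)); N05 ∕ N07 NOT discharged; counts unmoved (typed 28∕28 · discharged 8∕27); one finite 𝕋⁴ programme at fixed ε — R4 closes
the conditional finite-𝕋⁴ rung `BalabanLadder.UV` only; the YM mass gap (Clay) is NOT proved by any of this; nothing continuum ∕ ℝ⁴ ∕ OS.  No `def`, no `instance`, no `notation`, no `sorry`.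

References: [3] Prop. 2 (52)–(54) p. 26, p. 25, (43) p. 24; [6] (1.7)–(1.9) p. 77, (1.14)–(1.15) p. 78, pp. 98–99; [15] (144) p. 300, (147) p. 301, (181) p. 307; [I] (0.3)–(0.4) pp. 252–253,
(0.21) p. 256.
-/

set_option autoImplicit false

noncomputable section

open scoped Matrix.Norms.L2Operator

namespace Summit.QuantumFields.YangMills.BalabanUVNodes.N07TowerGaugeCoverLiftGuard

open Literature.MathematicalPhysics.QuantumFieldTheory.Balaban1983to89
open Literature.MathematicalPhysics.QuantumFieldTheory.Balaban1983to89.Node00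
open Summit.QuantumFields.Balaban3D.Carriers
open Summit.QuantumFields.YangMills.BalabanUVNodes.N07RadialHolCoverLift
open Summit.QuantumFields.YangMills.BalabanUVNodes.N07TowerGaugeCoverLift
open Summit.QuantumFields.YangMills.BalabanUVNodes.N07TowerGaugeCoverLiftWindow
open B15Eq112TorusCover (cover)
open B14DomainGeom (Pt)
open B7Prop1Explicit (hol treeWord axialFn e plaqWord U1)
open B7Prop1Local (InBox AgreeOn clampCfg clampCfg_agree clampCfg_mem pdevOn pdev_clampCfg_le)
open B7Prop2Explicit (rescale rescale_apply pdev le_pdev unitaryUnits unitaryUnits_le_U1 c2')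
open B7Prop2Rec (C0Z AvgClosedZ prop2_explicitZ avgClosedZ_unitaryUnits norm_WZ_sub_one_le_global)
open B7Prop2SpecialUnitary (specialUnitaryUnits mem_specialUnitaryUnits specialUnitaryUnits_le_unitaryUnits)
open BlockAveragingZd (offZ ctrShift bavgZ bavgZG avgIterZ avgIterZG SmallZ WZ bavgZG_eq_bavgZ_of_small avgIterZ_succ avgIterZG_succ)
open BlockAveraging (blockAvg)
open ExpMeanLog (expMeanLogSU deltaSU)
open B8Ineq130 (axialFn_congr inBox_of_le)
open B8Ineq130Rec (fl tlo thi tlo_zero thi_zero fl_mem pair_mem bavgZ_congr WZ_congr agree_level tlo_le_thi)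
open B8Ineq132 (InAk)
open B8Ineq132Rec (pdevOn_lt_of_inAk_box)
open B8Eq115GaugeFixingRec (tgZ tgZ_zero tgZ_succ localGaugeZ towerGaugeZ)
open B8Eq119TwistedAxialRec (flmZ iterate_fl_eq_flmZ)
open B8Eq131CubesRec (tcubeZ)
open B12GaugeOrbits021 (IsResidual)
open B15Eq177GaugeInvariance (blockLift)
open T4AxialGaugeRooted (axialGaugeAt)

/-! ## §1  Every loop variable of every level's unguarded average is near `1` when the finest field has small plaquettes everywhere -/

section Small

variable {d : ℕ} {𝔸 : Type*} [CStarAlgebra 𝔸] [Nontrivial 𝔸]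

/-- ★ **[3] PROP. 2 + p. 25 FOR THE RECORD, ALL LEVELS**: a unitary-valued `V` on `ℤᵈ` (odd `L ≥ 2`… any `L ≥ 2`) with `sup_p |V(∂p) − 1| < α₀·L^{−2k}` and `C₀α₀ ≤ 1∕3`, `2α₀ ≤ c₂′`,
`512(d+1)(d+4)L²·(2α₀) ≤ 1` has, at EVERY level `j ≤ k`, every (0.4) loop variable of `Ūʲ = avgIterZ L V j` within `2θ` of `1`, `θ = 8(d+1)(d+4)L²·(2α₀)` — dag-n05-e's record Prop. 2
(`prop2_explicitZ` at each `j`: `sup |Ūʲ(∂p) − 1| < α₀ + 2C₀α₀² ≤ 2α₀`) and `norm_WZ_sub_one_le_global`. [cite: Balaban1985Averaging, Prop. 2 (52)–(54) p.26, p.25; Balaban1987RG1, (0.4) p.253] -/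
theorem norm_WZ_avgIterZ_sub_one_le {L : ℕ} (hL : 2 ≤ L) {k : ℕ} (V : B7Prop1Explicit.Site d → Fin d → 𝔸ˣ) (hV : ∀ x κ, V x κ ∈ unitaryUnits 𝔸)
    {α₀ : ℝ} (hα : 0 < α₀) (hα3 : C0Z d * α₀ ≤ 1 / 3) (hα2 : 2 * α₀ ≤ c2' d L) (hsmall : 512 * (d + 1) * (d + 4) * (L : ℝ) ^ 2 * (2 * α₀) ≤ 1)
    (h52 : pdev V < α₀ * (((L : ℝ) ^ k)⁻¹) ^ 2) {j : ℕ} (hj : j ≤ k) (q : B7Prop1Explicit.Site d) (κ : Fin d) (i : BlockAveragingZd.IdxZ d L) :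
    ‖((WZ L (avgIterZ L V j) q κ i : 𝔸ˣ) : 𝔸) - 1‖ ≤ 2 * (8 * (d + 1) * (d + 4) * (L : ℝ) ^ 2 * (2 * α₀)) := by
  have hL1 : 1 ≤ L := le_trans (by norm_num) hL
  have hL1r : (1 : ℝ) ≤ L := by exact_mod_cast hL1
  -- Prop. 2 up to level `j`: the threshold at level `j` is weaker than at level `k`
  have h52j : pdev V < α₀ * (((L : ℝ) ^ j)⁻¹) ^ 2 := by
    refine lt_of_lt_of_le h52 (mul_le_mul_of_nonneg_left ?_ hα.le)
    have h1 : (L : ℝ) ^ j ≤ (L : ℝ) ^ k := pow_le_pow_right₀ hL1r hj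
    have h2 : (0 : ℝ) < (L : ℝ) ^ j := by positivity
    gcongr
  obtain ⟨hpd, hmem⟩ := prop2_explicitZ L hL (avgClosedZ_unitaryUnits _ L) j V hV hα hα3 hα2 h52j
  have hU1 : ∀ x κ', avgIterZ L V j x κ' ∈ U1 𝔸 := fun x κ' => unitaryUnits_le_U1 (hmem j le_rfl x κ')
  have h2α : α₀ + 2 * C0Z d * α₀ ^ 2 ≤ 2 * α₀ := by nlinarith
  refine norm_WZ_sub_one_le_global L hL1 (avgIterZ L V j) hU1 (by positivity) hsmall (fun x κ₁ κ₂ _ => ?_) q κ i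
  exact ((le_pdev hU1 x κ₁ κ₂).trans hpd.le).trans h2α

end Small

/-! ## §2  Unguarded CLAMPED averages = guarded averages on the windows, under the clamped field's loop smallness -/

section Agree

variable {d : ℕ} {𝔸 : Type*} [NormedRing 𝔸] [NormedAlgebra ℂ 𝔸] [CompleteSpace 𝔸]

/-- ★ **CLAMPED∕UNGUARDED = UNCLAMPED∕GUARDED ON THE WINDOWS** when the clamped field's unguarded averages have all loop variables inside the guard: for `j ≤ k`,
`AgreeOn (tlo (k−j)) (thi (k−j)) (avgIterZ L (clampCfg (tlo k) (thi k) V) j) (avgIterZG L δ V j)` — base `clampCfg_agree`; step: the guarded average's guard at `L•q` holds because its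
loop variables there ARE the clamped unguarded ones (`WZ_congr` on the pair box, induction hypothesis), then `bavgZG_eq_bavgZ_of_small` and `bavgZ_congr`.
[cite: Balaban1987RG1, (0.4) p.253; Balaban1985Averaging, p.24 (locality of (42)); Balaban1985RegularSpaces, p.99 («by the construction of U₀″»)] -/
theorem avgIterZ_clampCfg_agree_avgIterZG_of_smallZ {L s : ℕ} (hL : L = 2 * s + 1) {lo hi : B7Prop1Explicit.Site d} {k : ℕ} (V : B7Prop1Explicit.Site d → Fin d → 𝔸ˣ) (δ : ℝ)
    (hs : ∀ i, i < k → ∀ (q : B7Prop1Explicit.Site d) (κ : Fin d), tlo L lo (k - (i + 1)) ≤ q → q + e κ ≤ thi L hi (k - (i + 1)) →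
      SmallZ L δ (avgIterZ L (clampCfg (tlo L lo k) (thi L hi k) V) i) ((L : ℤ) • q) κ) :
    ∀ j, j ≤ k → AgreeOn (tlo L lo (k - j)) (thi L hi (k - j)) (avgIterZ L (clampCfg (tlo L lo k) (thi L hi k) V) j) (avgIterZG L δ V j)
  | 0, _ => by rw [Nat.sub_zero]; exact clampCfg_agree V
  | j + 1, hj => by
    intro q κ hq hqκ
    rw [avgIterZ_succ, avgIterZG_succ, rescale_apply, rescale_apply]
    have hq1 : tlo L lo (k - (j + 1)) ≤ q := fun i => (hq i).1
    have hq2 : q + e κ ≤ thi L hi (k - (j + 1)) := fun i => (hqκ i).2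
    have ih := avgIterZ_clampCfg_agree_avgIterZG_of_smallZ hL V δ hs j (by omega)
    rw [show k - j = k - (j + 1) + 1 by omega] at ih
    have hpm := pair_mem (L := L) (lo := lo) (hi := hi) (z := q) (κ := κ) hq1 hq2
    -- the guard of the GUARDED average at `L•q`: its loop variables are the clamped unguarded ones
    have hsmallG : SmallZ L δ (avgIterZG L δ V j) ((L : ℤ) • q) κ := by
      intro i
      rw [← WZ_congr hL ih _ κ hpm.1 hpm.2 i]
      exact hs j (by omega) q κ hq1 hq2 i
    rw [bavgZG_eq_bavgZ_of_small L hsmallG]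
    exact bavgZ_congr hL ih _ κ hpm.1 hpm.2

/-- ★★ **`localGaugeZ = tgZ` of the GUARDED averages on the fine window**, under the clamped field's loop smallness (§3's route; `tgZ_congr` of FILE-3).
[cite: Balaban1985RegularSpaces, p.98, (1.15) p.78; Balaban1987RG1, (0.3)–(0.4) pp.252–253] -/
theorem localGaugeZ_eq_tgZ_avgIterZG_of_smallZ_clamp {L s : ℕ} (hL : L = 2 * s + 1) {lo hi : B7Prop1Explicit.Site d} {k : ℕ} (V : B7Prop1Explicit.Site d → Fin d → 𝔸ˣ) (δ : ℝ)
    (hs : ∀ i, i < k → ∀ (q : B7Prop1Explicit.Site d) (κ : Fin d), tlo L lo (k - (i + 1)) ≤ q → q + e κ ≤ thi L hi (k - (i + 1)) →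
      SmallZ L δ (avgIterZ L (clampCfg (tlo L lo k) (thi L hi k) V) i) ((L : ℤ) • q) κ)
    {y : B7Prop1Explicit.Site d} (hy : lo ≤ y) (hy' : y ≤ hi) {x : B7Prop1Explicit.Site d} (hx : tlo L lo k ≤ x) (hx' : x ≤ thi L hi k) :
    localGaugeZ L lo hi V k y x = tgZ L (avgIterZG L δ V) k y k x := by
  refine tgZ_congr hL (fun n hn => ?_) hy hy' k le_rfl x hx hx'
  have h := avgIterZ_clampCfg_agree_avgIterZG_of_smallZ hL (lo := lo) (hi := hi) V δ hs (k - n) (Nat.sub_le k n)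
  rwa [Nat.sub_sub_self hn] at h

end Agree

/-! ## §3  At the objects of the knit: the identification from the door's OWN input `InAk … (fun _ => □̃ᶻ) V` -/

section Torus

variable {P : Params} (N : ℕ) [NeZero N]

/-- ★★★ **THE DOOR's `v` IS THE CHART's `h̄·w` ON `□̃ᶻ`, FROM THE DOOR's OWN INPUT**: for `k ≤ m + K`, a torus field `U` whose top-anchored lift `V` is in the (1.7)∕(1.9) class
`InAk L k η_k α {□̃ᶻ} V` (g10 FILE-8 `inAk_coverLiftShift_tcubeZ_of_top` supplies it from the run's bounds), `α₀ := α·L²` inside [3] Prop. 2's window (`C₀α₀ ≤ 1∕3`, `2α₀ ≤ c₂′`,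
`512(d+1)(d+4)L²·2α₀ ≤ 1`) and the (0.4) guard (`2θ < δ_N`, `θ = 8(d+1)(d+4)L²·2α₀`), a RESIDUAL `w` with `M^i(U^w)` radial-axial below `k`, `1 ≤ M`, the no-wrap `M + 4ρ ≤ sitesPerDir k`
and `x ∈ □̃ᶻ = tcubeZ L a M ρ k`:  `localGaugeZ L (tLo a ρ) (tHi a M ρ) V k (ctr a M) x = ιSU (h̄(π(x + c_k·𝟙)) · w(π(x + c_k·𝟙)))`, `h = axialGaugeAt (M^k(U^w)) (tLo a ρ) (tHi a M ρ) (ctr a M)`.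
Chain: `pdevOn □̃ < αL²·L^{−2k}` (n05-d `pdevOn_lt_of_inAk_box`) ⇒ `pdev (clamped V) ≤ …` (`pdev_clampCfg_le`) ⇒ §1 ⇒ §2 ⇒ FILE-2.
[cite: Balaban1985RegularSpaces, p.98–99, (1.7) p.77, (1.14)–(1.15) p.78; Balaban1985Averaging, Prop. 2 p.26, p.25; Balaban1985Variational, (144) p.300, (147) p.301, (181) p.307; Balaban1987RG1, (0.3)–(0.4) pp.252–253, (0.21) p.256] -/
theorem localGaugeZ_coverLiftShift_eq_of_inAk {k : ℕ} (hk : k ≤ P.m + P.K) (U : GaugeField P 0 (SU N)) (w : GaugeTransf P 0 (SU N))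
    (hres : IsResidual k w)
    (hax : ∀ i, i < k → AxialGauge (radialContourData P i (SU N)) (Averaging.iter (fun _ => blockAvg expMeanLogSU) i (GaugeField.gaugeAct w U)))
    (a : Pt P.d) {M ρ : ℕ} (hM : 1 ≤ M) (hwrap : M + 4 * ρ ≤ P.sitesPerDir k) {α : ℝ} (hα : 0 < α)
    (hA : letI : CStarAlgebra (MatA N) := {};
      InAk P.L k (P.eta k) α (fun _ => tcubeZ P.L a M ρ k) (fun x μ => ιSU N (U ⟨cover P (x + fun _ => ((ctrShift P.L k : ℕ) : ℤ)), μ⟩)))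
    (hα3 : C0Z P.d * (α * (P.L : ℝ) ^ 2) ≤ 1 / 3) (hα2 : 2 * (α * (P.L : ℝ) ^ 2) ≤ c2' P.d P.L)
    (hsmall : 512 * (P.d + 1) * (P.d + 4) * (P.L : ℝ) ^ 2 * (2 * (α * (P.L : ℝ) ^ 2)) ≤ 1)
    (hδ : 2 * (8 * (P.d + 1) * (P.d + 4) * (P.L : ℝ) ^ 2 * (2 * (α * (P.L : ℝ) ^ 2))) < deltaSU (Fin N))
    {x : Pt P.d} (hx : x ∈ tcubeZ P.L a M ρ k) :
    letI : CStarAlgebra (MatA N) := {}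
    localGaugeZ P.L (B8Eq131Cubes.tLo a ρ) (B8Eq131Cubes.tHi a M ρ) (fun x μ => ιSU N (U ⟨cover P (x + fun _ => ((ctrShift P.L k : ℕ) : ℤ)), μ⟩)) k
        (B8Eq131Cubes.ctr a M) x =
      ιSU N (blockLift k (axialGaugeAt (Averaging.iter (fun _ => blockAvg expMeanLogSU) k (GaugeField.gaugeAct w U))
            (B8Eq131Cubes.tLo a ρ) (B8Eq131Cubes.tHi a M ρ) (B8Eq131Cubes.ctr a M))
          (cover P (x + fun _ => ((ctrShift P.L k : ℕ) : ℤ))) * w (cover P (x + fun _ => ((ctrShift P.L k : ℕ) : ℤ)))) := by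
  letI : CStarAlgebra (MatA N) := {}
  obtain ⟨s, hs'⟩ := P.hL.1
  have hL : P.L = 2 * s + 1 := by omega
  have hL2 : 2 ≤ P.L := P.hL.2
  set V : Pt P.d → Fin P.d → (MatA N)ˣ := fun x μ => ιSU N (U ⟨cover P (x + fun _ => ((ctrShift P.L k : ℕ) : ℤ)), μ⟩) with hV
  have hVu : ∀ x κ, V x κ ∈ unitaryUnits (MatA N) := fun x κ =>
    specialUnitaryUnits_le_unitaryUnits (mem_specialUnitaryUnits.2 (U ⟨cover P (x + fun _ => ((ctrShift P.L k : ℕ) : ℤ)), κ⟩).2)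
  set lo : Pt P.d := B8Eq131Cubes.tLo a ρ with hlo
  set hi : Pt P.d := B8Eq131Cubes.tHi a M ρ with hhi
  have hlohi : lo ≤ hi := B8Eq131Cubes.tLo_le_tHi hM
  -- the clamped field's plaquettes: `sup_p |V_c(∂p) − 1| ≤ sup_{p ⊂ □̃} |V(∂p) − 1| < αL²·L^{−2k}`
  have hVc : ∀ x κ, clampCfg (tlo P.L lo k) (thi P.L hi k) V x κ ∈ unitaryUnits (MatA N) := fun x κ => clampCfg_mem hVu x κ
  have hpdOn := pdevOn_lt_of_inAk_box (lo := tlo P.L lo k) (hi := thi P.L hi k) (le_trans (by norm_num) hL2) hα hA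
    ⟨k, le_rfl, Nat.le_succ k, fun x hx => hx⟩
  have h52 : pdev (clampCfg (tlo P.L lo k) (thi P.L hi k) V) < (α * (P.L : ℝ) ^ 2) * (((P.L : ℝ) ^ k)⁻¹) ^ 2 := by
    refine lt_of_le_of_lt (pdev_clampCfg_le (fun i => tlo_le_thi P.L hlohi k i) fun x κ => unitaryUnits_le_U1 (hVu x κ)) ?_
    simpa only [mul_assoc] using hpdOn
  have hα' : 0 < α * (P.L : ℝ) ^ 2 := by positivity
  -- §1: every loop variable of every level of the clamped field's averages is within `2θ < δ_N` of `1`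
  have hsZ : ∀ i, i < k → ∀ (q : Pt P.d) (κ : Fin P.d), tlo P.L lo (k - (i + 1)) ≤ q → q + e κ ≤ thi P.L hi (k - (i + 1)) →
      SmallZ P.L (deltaSU (Fin N)) (avgIterZ P.L (clampCfg (tlo P.L lo k) (thi P.L hi k) V) i) ((P.L : ℤ) • q) κ :=
    fun i hi q κ _ _ idx => lt_of_le_of_lt (norm_WZ_avgIterZ_sub_one_le hL2 _ hVc hα' hα3 hα2 hsmall h52 hi.le _ κ idx) hδ
  have hc := B8Eq131Cubes.ctr_mem (a := a) (ρ := ρ) hM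
  have hN' : ∀ κ, hi κ - lo κ < P.sitesPerDir k := by
    intro κ
    have h : ((M + 4 * ρ : ℕ) : ℤ) ≤ P.sitesPerDir k := by exact_mod_cast hwrap
    simp only [hlo, hhi, B8Eq131Cubes.tLo, B8Eq131Cubes.tHi]
    push_cast at h ⊢
    omega
  have hwin := iterate_fl_mem hL k (fun i => (hx i).1) (fun i => (hx i).2)
  rw [iterate_fl_eq_flmZ P.hL.1] at hwin
  rw [localGaugeZ_eq_tgZ_avgIterZG_of_smallZ_clamp hL V (deltaSU (Fin N)) hsZ hc.1 hc.2.1 (fun i => (hx i).1) (fun i => (hx i).2),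
    towerGaugeZ_avgIterZG_coverLift_eq_blockLift_axialGaugeAt_mul N hk U w hres hax (B8Eq131Cubes.ctr a M) hN' hwin.1 hwin.2]

end Torus

end Summit.QuantumFields.YangMills.BalabanUVNodes.N07TowerGaugeCoverLiftGuard

end

/-! ## Axiom audit (gate whitelist: `propext`, `Classical.choice`, `Quot.sound`) -/
#print axioms Summit.QuantumFields.YangMills.BalabanUVNodes.N07TowerGaugeCoverLiftGuard.localGaugeZ_coverLiftShift_eq_of_inAk
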